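import Summits.Ventures.CertifiedArithmetic.LowPrec.SRHoeffding
import Summits.Ventures.CertifiedArithmetic.LowPrec.SRLimitedBits
import HarnessLib

/-!
# Exponential envelope for limited-randomness SR (P3109 StochasticA/B/C): a bias-shifted Hoeffding tail

HONEST FRAMING: certified error envelopes and provably optimal rounding/accumulation schemes for
low-precision formats under stated cost models; every table by two implementations; no hardware or
vendor claims.

With `N` random bits the rounding step is still a two-point law on the candidates, but with a perturbed
up-probability (`SRLimitedBits.stepQ F q`, `|q η − η| ≤ ε` on `[0,1]`), so the chain is a martingale plus a
predictable drift of size `≤ ε G` per step.  Over `K = ℝ` we prove, under `NoSat ∧ GapLE G`: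

* `stepQ_exp_le` — `E[e^{t(result − c̄)}] ≤ e^{t²G²/8 + |t| ε G}` (Hoeffding about the perturbed mean,
  then the drift `|mean − c̄| ≤ ε G` of `abs_stepQ_id_sub_le`);
* `accExpQ_exp_le` — `E_s[e^{t(ŝₙ − s − ∑xₖ)}] ≤ e^{n (t²G²/8 + |t| ε G)}`;
* `accExpQ_prob_dev_ge_le_exp` — the **shifted tail** `P(|ŝₙ − s − ∑xₖ| ≥ t + n ε G) ≤ 2 exp(−2t²/(n G²))`:
  the same `√n` fluctuation as exact SR around a worst-case drift `n ε G` (`ε = 2^{-N}` for StochasticA,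
  `2^{-(N+1)}` for B and C: `stochasticA/B/C_prob_dev_ge_le_exp`).
-/

namespace Summit.Ventures.CertifiedArithmetic.LowPrec.SR.LimitedBits

open Literature.ComputerArithmetic.P3109
open Literature.ComputerArithmetic.ConnollyHighamMary2021
open Summit.Ventures.CertifiedArithmetic.LowPrec.SR
open Finset Real

/-! ### One perturbed step -/

/-- Scalars pull out of a perturbed step. -/
theorem stepQ_mul_left (F : Finset ℝ) (q : ℝ → ℝ) (c a : ℝ) (f : ℝ → ℝ) :
    stepQ F q c (fun v => a * f v) = a * stepQ F q c f := by
  unfold stepQ; ring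

/-- Monotonicity of a perturbed step through its two leaves (needs `pUpQ ∈ [0,1]`). -/
theorem stepQ_mono_of (F : Finset ℝ) {q : ℝ → ℝ}
    (hq01 : ∀ η, 0 ≤ η → η ≤ 1 → 0 ≤ q η ∧ q η ≤ 1) (c : ℝ) {f g : ℝ → ℝ}
    (hu : f (up F c) ≤ g (up F c)) (hd : f (dn F c) ≤ g (dn F c)) :
    stepQ F q c f ≤ stepQ F q c g := by
  obtain ⟨hp0, hp1⟩ := pUpQ_mem F hq01 c
  unfold stepQ
  nlinarith [mul_le_mul_of_nonneg_left hu hp0, mul_le_mul_of_nonneg_left hd (sub_nonneg.mpr hp1)]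

/-- **One perturbed step.** If `q` maps `[0,1]` into `[0,1]` with `|q η − η| ≤ ε` and the candidate gap
of `c̄` is `≤ G`, then `E[e^{t(result − c̄)}] ≤ exp(t²G²/8 + |t| ε G)`. -/
theorem stepQ_exp_le (F : Finset ℝ) {q : ℝ → ℝ} {ε : ℝ}
    (hq01 : ∀ η, 0 ≤ η → η ≤ 1 → 0 ≤ q η ∧ q η ≤ 1) (hq : ∀ η, 0 ≤ η → η ≤ 1 → |q η - η| ≤ ε)
    (c t : ℝ) {G : ℝ} (hg : roundUp F (clamp F c) - roundDown F (clamp F c) ≤ G) :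
    stepQ F q c (fun v => exp (t * (v - clamp F c))) ≤ exp (t ^ 2 * G ^ 2 / 8 + |t| * (ε * G)) := by
  obtain ⟨hp0, hp1⟩ := pUpQ_mem F hq01 c
  set m := pUpQ F q c * up F c + (1 - pUpQ F q c) * dn F c with hm
  have hgap0 : 0 ≤ up F c - dn F c := sub_nonneg.mpr (dn_le_up F c)
  have hgap : up F c - dn F c ≤ G := hg
  have hε : 0 ≤ ε := (abs_nonneg _).trans (hq 0 le_rfl zero_le_one)
  -- Hoeffding about the perturbed mean
  have hH := two_point_hoeffding hp0 hp1 (dn_le_up F c) t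
  rw [← hm] at hH
  have hH' : pUpQ F q c * exp (t * (up F c - m)) + (1 - pUpQ F q c) * exp (t * (dn F c - m))
      ≤ exp (t ^ 2 * G ^ 2 / 8) := by
    refine hH.trans (exp_le_exp.mpr ?_)
    have h1 : (up F c - dn F c) ^ 2 ≤ G ^ 2 := by
      rw [sq, sq]; exact mul_self_le_mul_self hgap0 hgap
    nlinarith [sq_nonneg t]
  -- the drift
  have hdrift : |m - clamp F c| ≤ ε * G := by
    have h := abs_stepQ_id_sub_le F hq c
    have hid : stepQ F q c (fun t => t) = m := by unfold stepQ; rw [hm]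
    rw [hid] at h
    exact h.trans (mul_le_mul_of_nonneg_left hgap hε)
  have hshift : exp (t * (m - clamp F c)) ≤ exp (|t| * (ε * G)) := by
    refine exp_le_exp.mpr ?_
    calc t * (m - clamp F c) ≤ |t * (m - clamp F c)| := le_abs_self _
      _ = |t| * |m - clamp F c| := abs_mul _ _
      _ ≤ |t| * (ε * G) := mul_le_mul_of_nonneg_left hdrift (abs_nonneg t)
  -- factor the observable through the perturbed mean
  have hfac : stepQ F q c (fun v => exp (t * (v - clamp F c)))
      = exp (t * (m - clamp F c)) * (pUpQ F q c * exp (t * (up F c - m))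
          + (1 - pUpQ F q c) * exp (t * (dn F c - m))) := by
    unfold stepQ
    simp only []
    have e1 : exp (t * (up F c - clamp F c)) = exp (t * (m - clamp F c)) * exp (t * (up F c - m)) := by
      rw [← exp_add]; ring_nf
    have e2 : exp (t * (dn F c - clamp F c)) = exp (t * (m - clamp F c)) * exp (t * (dn F c - m)) := by
      rw [← exp_add]; ring_nf
    rw [e1, e2]; ring
  rw [hfac, exp_add, mul_comm (exp (t ^ 2 * G ^ 2 / 8))]
  exact mul_le_mul hshift hH' (by positivity) (by positivity)

/-! ### The chain -/

/-- Scalars pull out of the perturbed recursion. -/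
theorem accExpQ_mul_left (F : Finset ℝ) (q : ℝ → ℝ) :
    ∀ (n : ℕ) (x : ℕ → ℝ) (a : ℝ) (f : ℝ → ℝ) (s : ℝ),
      accExpQ F q x n (fun v => a * f v) s = a * accExpQ F q x n f s := by
  intro n
  induction n with
  | zero => intro x a f s; rfl
  | succ n ih =>
      intro x a f s
      simp only [accExpQ]
      rw [← stepQ_mul_left]
      congr 1; funext v; exact ih _ a f v

/-- Additivity of the perturbed recursion. -/
theorem accExpQ_add (F : Finset ℝ) (q : ℝ → ℝ) :
    ∀ (n : ℕ) (x : ℕ → ℝ) (f g : ℝ → ℝ) (s : ℝ),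
      accExpQ F q x n (fun v => f v + g v) s = accExpQ F q x n f s + accExpQ F q x n g s := by
  intro n
  induction n with
  | zero => intro x f g s; rfl
  | succ n ih =>
      intro x f g s
      simp only [accExpQ]
      rw [← stepQ_add]
      congr 1; funext v; exact ih _ f g v

/-- Monotonicity of the perturbed recursion in the observable. -/
theorem accExpQ_mono (F : Finset ℝ) {q : ℝ → ℝ}
    (hq01 : ∀ η, 0 ≤ η → η ≤ 1 → 0 ≤ q η ∧ q η ≤ 1) :
    ∀ (n : ℕ) (x : ℕ → ℝ) {f g : ℝ → ℝ}, (∀ v, f v ≤ g v) → ∀ s : ℝ,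
      accExpQ F q x n f s ≤ accExpQ F q x n g s := by
  intro n
  induction n with
  | zero => intro x f g h s; exact h s
  | succ n ih =>
      intro x f g h s
      simp only [accExpQ]
      exact stepQ_mono_of F hq01 _ (ih _ h _) (ih _ h _)

/-- **MGF bound for limited-randomness SR summation.** Under `NoSat ∧ GapLE G`, for every real `t`,
`E_s[e^{t(ŝₙ − s − ∑xₖ)}] ≤ exp(n (t²G²/8 + |t| ε G))`. -/
theorem accExpQ_exp_le (F : Finset ℝ) {q : ℝ → ℝ} {ε : ℝ}
    (hq01 : ∀ η, 0 ≤ η → η ≤ 1 → 0 ≤ q η ∧ q η ≤ 1) (hq : ∀ η, 0 ≤ η → η ≤ 1 → |q η - η| ≤ ε)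
    (G t : ℝ) :
    ∀ (n : ℕ) (x : ℕ → ℝ) (s : ℝ), NoSat F x n s → GapLE F G x n s →
      accExpQ F q x n (fun v => exp (t * (v - (s + ∑ i ∈ range n, x i)))) s
        ≤ exp (n * (t ^ 2 * G ^ 2 / 8 + |t| * (ε * G))) := by
  intro n
  induction n with
  | zero => intro x s _ _; simp [accExpQ]
  | succ n ih =>
      intro x s h hg
      obtain ⟨hc, hu, hd⟩ := h
      obtain ⟨hgap, hgu, hgd⟩ := hg
      simp only [accExpQ]
      rw [sum_range_succ' x n]
      set S := ∑ i ∈ range n, x (i + 1) with hS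
      set c := s + x 0 with hc_def
      set B := exp (n * (t ^ 2 * G ^ 2 / 8 + |t| * (ε * G))) with hB
      have hcl : clamp F c = c := clamp_eq_self hc
      have leaf : ∀ ℓ, NoSat F (fun i => x (i + 1)) n ℓ → GapLE F G (fun i => x (i + 1)) n ℓ →
          accExpQ F q (fun i => x (i + 1)) n (fun v => exp (t * (v - (s + (S + x 0))))) ℓ
            ≤ exp (t * (ℓ - c)) * B := by
        intro ℓ h1 h2
        have hf : (fun v => exp (t * (v - (s + (S + x 0)))))
            = fun v => exp (t * (ℓ - c)) * exp (t * (v - (ℓ + ∑ i ∈ range n, x (i + 1)))) := by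
          funext v; rw [← exp_add, ← hS, hc_def]; ring_nf
        rw [hf, accExpQ_mul_left]
        exact mul_le_mul_of_nonneg_left (ih _ _ h1 h2) (exp_pos _).le
      calc stepQ F q c (accExpQ F q (fun i => x (i + 1)) n
              (fun v => exp (t * (v - (s + (S + x 0))))))
          ≤ stepQ F q c (fun ℓ => B * exp (t * (ℓ - clamp F c))) := by
            refine stepQ_mono_of F hq01 c ?_ ?_
            · rw [hcl, mul_comm]; exact leaf _ hu hgu
            · rw [hcl, mul_comm]; exact leaf _ hd hgd
        _ = B * stepQ F q c (fun ℓ => exp (t * (ℓ - clamp F c))) := stepQ_mul_left F q c B _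
        _ ≤ B * exp (t ^ 2 * G ^ 2 / 8 + |t| * (ε * G)) :=
            mul_le_mul_of_nonneg_left (stepQ_exp_le F hq01 hq c t hgap) (exp_pos _).le
        _ = exp (↑(n + 1) * (t ^ 2 * G ^ 2 / 8 + |t| * (ε * G))) := by
            rw [hB, ← exp_add]; push_cast; ring_nf

/-! ### The bias-shifted exponential tail -/

/-- **Shifted exponential envelope for limited-randomness SR.** If `q : [0,1] → [0,1]` with
`|q η − η| ≤ ε`, no branch saturates and every candidate gap is `≤ G` (`0 ≤ G`), then for every `t > 0`
`P(|ŝₙ − s − ∑ₖ xₖ| ≥ t + n ε G) ≤ 2 exp(−2t²/(n G²))`. -/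
theorem accExpQ_prob_dev_ge_le_exp (F : Finset ℝ) {q : ℝ → ℝ} {ε : ℝ}
    (hq01 : ∀ η, 0 ≤ η → η ≤ 1 → 0 ≤ q η ∧ q η ≤ 1) (hq : ∀ η, 0 ≤ η → η ≤ 1 → |q η - η| ≤ ε)
    {G : ℝ} (hG : 0 ≤ G) (x : ℕ → ℝ) (n : ℕ) (s : ℝ) (h : NoSat F x n s) (hg : GapLE F G x n s)
    (t : ℝ) (ht : 0 < t) :
    accExpQ F q x n (devInd (t + n * (ε * G)) (s + ∑ i ∈ range n, x i)) s
      ≤ 2 * exp (-2 * t ^ 2 / (n * G ^ 2)) := by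
  have hε : 0 ≤ ε := (abs_nonneg _).trans (hq 0 le_rfl zero_le_one)
  have hD0 : 0 ≤ n * (ε * G) := by positivity
  set m := s + ∑ i ∈ range n, x i with hm
  set T := t + n * (ε * G) with hT
  -- one-sided Chernoff bounds for θ ≥ 0
  have one_sided : ∀ {θ : ℝ}, 0 ≤ θ →
      accExpQ F q x n (upDevInd T m) s ≤ exp (-(θ * T)) * exp (n * (θ ^ 2 * G ^ 2 / 8 + θ * (ε * G)))
      ∧ accExpQ F q x n (dnDevInd T m) s
          ≤ exp (-(θ * T)) * exp (n * (θ ^ 2 * G ^ 2 / 8 + θ * (ε * G))) := by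
    intro θ hθ
    have hab : |θ| = θ := abs_of_nonneg hθ
    have hab' : |-θ| = θ := by rw [abs_neg, hab]
    constructor
    · calc accExpQ F q x n (upDevInd T m) s
          ≤ accExpQ F q x n (fun v => exp (-(θ * T)) * exp (θ * (v - m))) s :=
            accExpQ_mono F hq01 n x (fun v => upDevInd_le_exp T m v hθ) s
        _ ≤ exp (-(θ * T)) * exp (n * (θ ^ 2 * G ^ 2 / 8 + θ * (ε * G))) := by
            rw [accExpQ_mul_left]
            refine mul_le_mul_of_nonneg_left ?_ (exp_pos _).le
            have := accExpQ_exp_le F hq01 hq G θ n x s h hg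
            rwa [hab] at this
    · calc accExpQ F q x n (dnDevInd T m) s
          ≤ accExpQ F q x n (fun v => exp (-(θ * T)) * exp (-θ * (v - m))) s :=
            accExpQ_mono F hq01 n x (fun v => dnDevInd_le_exp T m v hθ) s
        _ ≤ exp (-(θ * T)) * exp (n * (θ ^ 2 * G ^ 2 / 8 + θ * (ε * G))) := by
            rw [accExpQ_mul_left]
            refine mul_le_mul_of_nonneg_left ?_ (exp_pos _).le
            have := accExpQ_exp_le F hq01 hq G (-θ) n x s h hg
            rwa [hab', neg_sq] at this
  have hsplit : accExpQ F q x n (devInd T m) s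
      ≤ accExpQ F q x n (upDevInd T m) s + accExpQ F q x n (dnDevInd T m) s := by
    rw [← accExpQ_add]; exact accExpQ_mono F hq01 n x (fun v => devInd_le_up_add_dn T m v) s
  by_cases hD : n * G ^ 2 = 0
  · have h1 := one_sided le_rfl
    simp only [zero_mul, neg_zero, exp_zero, one_mul, ne_eq, zero_pow, OfNat.ofNat_ne_zero,
      not_false_eq_true, zero_div, zero_add, mul_zero] at h1
    rw [hD, div_zero, exp_zero, mul_one]
    linarith [h1.1, h1.2]
  · have hpos : 0 < n * G ^ 2 := lt_of_le_of_ne (by positivity) (Ne.symm hD)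
    set θ := 4 * t / (n * G ^ 2) with hθ
    have hθ0 : 0 ≤ θ := by positivity
    have h1 := one_sided hθ0
    -- θ T = θ t + θ n ε G: the drift term cancels exactly
    have key : exp (-(θ * T)) * exp (n * (θ ^ 2 * G ^ 2 / 8 + θ * (ε * G)))
        = exp (-2 * t ^ 2 / (n * G ^ 2)) := by
      rw [← exp_add]; congr 1
      rw [hT, hθ]; field_simp; ring
    rw [key] at h1
    linarith [h1.1, h1.2]

/-- **StochasticA (`N` bits)**: `P(|ŝₙ − s − ∑xₖ| ≥ t + n G 2^{-N}) ≤ 2 exp(−2t²/(n G²))`. -/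
theorem stochasticA_prob_dev_ge_le_exp (F : Finset ℝ) (N : ℕ) {G : ℝ} (hG : 0 ≤ G) (x : ℕ → ℝ)
    (n : ℕ) (s : ℝ) (h : NoSat F x n s) (hg : GapLE F G x n s) (t : ℝ) (ht : 0 < t) :
    accExpQ F (probAwayA N) x n (devInd (t + n * (1 / 2 ^ N * G)) (s + ∑ i ∈ range n, x i)) s
      ≤ 2 * exp (-2 * t ^ 2 / (n * G ^ 2)) :=
  accExpQ_prob_dev_ge_le_exp F (probAwayA_mem N) (fun η _ _ => abs_probAwayA_sub_le N η) hG x n s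
    h hg t ht

/-- **StochasticB (`N` bits)**: `P(|ŝₙ − s − ∑xₖ| ≥ t + n G 2^{-(N+1)}) ≤ 2 exp(−2t²/(n G²))`. -/
theorem stochasticB_prob_dev_ge_le_exp (F : Finset ℝ) (N : ℕ) {G : ℝ} (hG : 0 ≤ G) (x : ℕ → ℝ)
    (n : ℕ) (s : ℝ) (h : NoSat F x n s) (hg : GapLE F G x n s) (t : ℝ) (ht : 0 < t) :
    accExpQ F (probAwayB N) x n (devInd (t + n * (1 / 2 ^ (N + 1) * G)) (s + ∑ i ∈ range n, x i)) s
      ≤ 2 * exp (-2 * t ^ 2 / (n * G ^ 2)) :=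
  accExpQ_prob_dev_ge_le_exp F (probAwayB_mem N) (fun η _ _ => abs_probAwayB_sub_le N η) hG x n s
    h hg t ht

/-- **StochasticC (`N` bits)**: `P(|ŝₙ − s − ∑xₖ| ≥ t + n G 2^{-(N+1)}) ≤ 2 exp(−2t²/(n G²))`. -/
theorem stochasticC_prob_dev_ge_le_exp (F : Finset ℝ) (N : ℕ) {G : ℝ} (hG : 0 ≤ G) (x : ℕ → ℝ)
    (n : ℕ) (s : ℝ) (h : NoSat F x n s) (hg : GapLE F G x n s) (t : ℝ) (ht : 0 < t) :
    accExpQ F (probAwayC N) x n (devInd (t + n * (1 / 2 ^ (N + 1) * G)) (s + ∑ i ∈ range n, x i)) s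
      ≤ 2 * exp (-2 * t ^ 2 / (n * G ^ 2)) :=
  accExpQ_prob_dev_ge_le_exp F (probAwayC_mem N) (fun η _ _ => abs_probAwayC_sub_le N η) hG x n s
    h hg t ht

end Summit.Ventures.CertifiedArithmetic.LowPrec.SR.LimitedBits
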